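import Summits.Ventures.Crystal3D.Theorems.StickyWulffConstantNoReconstructionGainExactConfinementDefs
import HarnessLib

/-!
# The residual of the line `replication-exactness`, v5: the adhesion atom for cores with MANY wrapped
# off-lattice balls (definition)

HONEST FRAMING. Part of the venture `Summits/Ventures/Crystal3D` (cell `crystal3d-full`), supports the
crux `NoReconstructionGain` (stmt-Ventures-19144, route `route-Ventures-StickyWulffConstant`), line
`replication-exactness` (lead wulff-p1 g17).  DEFINITION ONLY.  Given EXACT₀, the level method
(`deficit_ge_of_exactZeroGain_sub_offLattice_deep`) proves the crux's inequality for every packing around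
the slab sample with at most `L·⌊(R−6)/2⌋·ρ` off-lattice balls in the deep band `(−2R+2, −R−2)` (wrapped
balls).  The honest residual — IMPLIED BY THE CRUX (it is the crux's adhesion atom on a subclass), unlike
the structural `CoreWrappedConfinement`, which implies it vacuously — is therefore:

* `ManyWrappedCoreAdhesion` — for some `L`, `R ≥ 8`, `C ≥ 0`: the adhesion atom
  `#cross(P, X∖P) ≤ D(X∖P) + Cρ` for every unit packing `X ⊇ P_ρ(ν,R)` (`ρ ≥ R`) whose film is a P-core
  AND has MORE than `L·⌊(R−6)/2⌋·ρ` off-lattice balls of height in `(−2R+2, −R−2)`.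

Compared with the retired UNWRAP (`WrappedCoreAdhesion`: all wrapped cores) the class is cut down to
cores carrying an off-lattice curtain of `≳ L R ρ / 2` balls in the deep band outside the disc.

WHAT THIS IS NOT: a theorem — definition only; nothing here proves the crux.
-/

noncomputable section

namespace Summit.Ventures.Crystal3D.Theorems

open Literature.MathematicalPhysics.StatisticalMechanics (fccStacking contactDeficiency)
open scoped InnerProductSpace
open Finset

open scoped Classical in
/-- **The adhesion atom for cores with many wrapped off-lattice balls** (residual of the line
`replication-exactness`, skeleton v5; implied by the crux). -/
def ManyWrappedCoreAdhesion : Prop :=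
  ∃ L R C : ℝ, 8 ≤ R ∧ 0 ≤ C ∧ ∀ ν : EuclideanSpace ℝ (Fin 3), ‖ν‖ = 1 → ∀ ρ : ℝ, R ≤ ρ →
    ∀ X P : Finset (EuclideanSpace ℝ (Fin 3)),
    (∀ p ∈ X, ∀ q ∈ X, p ≠ q → 1 ≤ dist p q) → P ⊆ X →
    (∀ p, p ∈ P ↔ (p ∈ fccStacking 1 (Real.sqrt (2 / 3)) ∧ -(2 * R) ≤ ⟪p, ν⟫_ℝ ∧
      ⟪p, ν⟫_ℝ ≤ -R ∧ ‖p‖ ^ 2 - ⟪p, ν⟫_ℝ ^ 2 ≤ ρ ^ 2)) →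
    (∀ S, S ⊆ X \ P → S.Nonempty →
      contactDeficiency S <
        (((((X \ S) ×ˢ S).filter fun pq => dist pq.1 pq.2 = 1).card : ℕ) : ℝ)) →
    L * (⌊(R - 6) / 2⌋₊ : ℕ) * ρ <
      (((X.filter fun x => x ∉ fccStacking 1 (Real.sqrt (2 / 3)) ∧ -(2 * R) + 2 < ⟪x, ν⟫_ℝ ∧
        ⟪x, ν⟫_ℝ < -R - 2).card : ℕ) : ℝ) →
    ((((P ×ˢ (X \ P)).filter fun pq => dist pq.1 pq.2 = 1).card : ℕ) : ℝ) ≤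
      contactDeficiency (X \ P) + C * ρ

end Summit.Ventures.Crystal3D.Theorems

end
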